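import Mathlib
import HarnessLib
import Summits.ValiantsHypothesis.ValiantsHypothesis.Theses.MonotoneRestoration
import Literature.Computability.AlgebraicComplexity.SymmetricCircuitLinCombOutputsSymmetry

/-! # Route MonotoneRestoration — crux `MonotoneRestorationQP`, line Sketch, stub Z5
(stmt-ValiantsHypothesis-15886)

**Output-wise linear combinations of symmetric circuits** (size calculus of Dawar–Wilsenach
square-symmetric circuits, THEOREM ζ of line Sketch). A `Γ`-symmetric Dawar–Wilsenach labelled
arithmetic circuit `C` over constants `K` and variables `X` with outputs indexed by `Y ⊕ Y` (two
`Γ`-equivariant output families `A_y = out_{inl y}`, `B_y = out_{inr y}` delivered by one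
circuit) and two constants `a, b ∈ K` yield ONE `Γ`-symmetric circuit with outputs indexed by
`Y` computing `y ↦ a · A_y + b · B_y`, on at most `|G| + 3 · |Y| + 4` gates.

Proof: the universe-`0` instance of the tree lemma
`LabelledArithCircuit.IsSymmetric.exists_linCombOutputs`
(`Literature/Computability/AlgebraicComplexity/SymmetricCircuitLinCombOutputsSymmetry.lean`,
gadget `LabelledArithCircuit.LinCombOutputs.circuit C Sum.inl Sum.inr a b` of
`SymmetricCircuitLinCombOutputs.lean`): on top of `C`, constant sources for `a`, `b` (an existing
constant gate of `C` when present, else a new one), unary sums `sa`, `sb` over them, and for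
every `y` the products `ma y = sa × out_{inl y}`, `mb y = sb × out_{inr y}` and the output
`out y = ma y + mb y`; an automorphism `π` of `C` over `γ` extends by the identity on the sources
and `sa`, `sb` and by `γ` on the three output layers (`γ • inl y = inl (γ • y)`).
-/

noncomputable section

-- `Summit.ValiantsHypothesis.ValiantsHypothesis.…` is the tree's mandated namespace (Sub = Summit).
set_option linter.dupNamespace false

namespace Summit.ValiantsHypothesis.ValiantsHypothesis.Theorems

open Literature.Computability.AlgebraicComplexity

/-- **Z5 — output-wise linear combinations of symmetric circuits** (crux `MonotoneRestorationQP`,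
line Sketch; registered stub `stub_symmetric_linCombOutputs`): a `Γ`-symmetric labelled circuit
over `K`, `X` with outputs indexed by `Y ⊕ Y` and constants `a`, `b` yield a `Γ`-symmetric
circuit with outputs `Y` computing `y ↦ a · out_{inl y} + b · out_{inr y}`, on at most
`|G| + 3 · |Y| + 4` gates. Instance of `LabelledArithCircuit.IsSymmetric.exists_linCombOutputs`. -/
theorem stub_symmetric_linCombOutputs {K X Y Γ G : Type} [CommSemiring K] [Group Γ]
    [MulAction Γ X] [MulAction Γ Y] [Fintype Y] [DecidableEq Y] [Fintype G]
    (C : LabelledArithCircuit K X (Y ⊕ Y) G) (hC : C.IsSymmetric Γ) (a b : K) :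
    ∃ (G' : Type) (_ : Fintype G') (C' : LabelledArithCircuit K X Y G'),
      C'.IsSymmetric Γ ∧
      (∀ y, C'.eval (C'.output y) =
        MvPolynomial.C a * C.eval (C.output (Sum.inl y)) +
          MvPolynomial.C b * C.eval (C.output (Sum.inr y))) ∧
      Fintype.card G' ≤ Fintype.card G + 3 * Fintype.card Y + 4 :=
  hC.exists_linCombOutputs C a b

end Summit.ValiantsHypothesis.ValiantsHypothesis.Theorems

end
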